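import Summits.Parity.GeneralizedHardyLittlewood.Theorems.LeeYangFibresRelativeDimOneMoebiusSplitMoebiusTermBVAux5
import Summits.Parity.GeneralizedHardyLittlewood.Theorems.LeeYangFibresRelativeDimOneMoebiusSplitMoebiusTermBVAux6
import HarnessLib

/-!
# Route `LeeYangFibres`, crux `RelativeDimOne` (stmt-Parity-14113), line `single-moebius-split`:
# helper file 7 for the stub `stub_moebiusTermBV` — summing the tuple bounds

`moebiusTermSum_le_explicit`: the pure-Möbius term `∑_{n ∈ K∩ℤ} (Λ − Λ_{R_0})(ψ₀(n)) ∏_{i≥1} Λ_{R_i}(ψ_i(n))`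
of a non-degenerate `d = 1` system of size `≤ L` is at most
`W^k · (2 L^k (3 X log X (1 + log Q_m)^{2^{2k+1}})^{1/2} S^{1/2} + P Q_m (log₂ X + 1) log X + X C e^{−c√log Rmin} L^k (1 + log Q_m)^{2^{k+1}} + P R_0 (log R_0 + 1))`,
where `X = 2LN`, `P = ∏_{i≥1} ⌊R_i⌋` (the number of sieve tuples), `Q_m = L P` (the largest modulus),
`W ≥ log R_i` (`i ≥ 1`), `G` is any non-negative modulus-wise majorant of the prime discrepancies
`|ψ(w; q, u) − w/φ(q)|` (`q ≤ Q_m`, `w ≤ X`, `u` a unit) with `∑_{q ≤ Q_m} G(q) ≤ S` and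
`G(q) ≤ 3 X log X τ(q)/q`, and `R_0 ≥ Rmin Q_m`, `Rmin ≥ max(1, Q_m)`.  Assembly of helper files 5
(expansion over tuples) and 6 (one tuple ↦ one class modulo `Q_t ≤ Q_m`): the tuples with a given
modulus `Q` number `≤ (L τ(Q))^k` (helper file 1, `card_fiber_le`), so by Cauchy–Schwarz
`∑_t G(Q_t) ≤ L^k (∑_Q τ(Q)^{2k} G(Q))^{1/2} (∑_Q G(Q))^{1/2}` with the trivial bound in the first
factor and `∑_{Q ≤ Q_m} τ(Q)^j/Q ≤ (1 + log Q_m)^{2^j}`.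

References: D. A. Goldston, C. Y. Yıldırım, Integers 3 (2003) A5 [GoldstonYildirim2001]; H. Iwaniec,
E. Kowalski, *Analytic Number Theory* (2004), Thm. 17.1 [IwaniecKowalski2004].
-/

noncomputable section

open Finset Literature.NumberTheory.Sieve
open scoped ArithmeticFunction.Moebius

namespace Summit.Parity.GeneralizedHardyLittlewood.Cruxes.RelativeDimOne.SingleMoebiusSplit

open Literature.NumberTheory.Sieve.ParityWave0 (chebyshevPsiMod)

/-- Size bookkeeping: `‖Ψ‖_N ≤ L` gives `|a_i| ≤ L` and `|b_i| ≤ L N` (`N ≥ 1`). [cite: GreenTao2010, (1.1)] -/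
theorem natAbs_le_of_affLinSize_le {t : ℕ} {Ψ : Fin t → AffLinForm 1} {N L : ℕ} (hN : 1 ≤ N)
    (h : affLinSize Ψ N ≤ L) (i : Fin t) :
    ((Ψ i).coeff 0).natAbs ≤ L ∧ ((Ψ i).const).natAbs ≤ L * N := by
  unfold affLinSize at h
  have h1 : 0 ≤ ∑ i, |(((Ψ i).const : ℤ) : ℝ) / N| := Finset.sum_nonneg fun _ _ => abs_nonneg _
  have h2 : 0 ≤ ∑ i, ∑ j, |(((Ψ i).coeff j : ℤ) : ℝ)| :=
    Finset.sum_nonneg fun _ _ => Finset.sum_nonneg fun _ _ => abs_nonneg _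
  have hcoeff : |(((Ψ i).coeff 0 : ℤ) : ℝ)| ≤ L := by
    have h3 : |(((Ψ i).coeff 0 : ℤ) : ℝ)| ≤ ∑ j, |(((Ψ i).coeff j : ℤ) : ℝ)| :=
      Finset.single_le_sum (f := fun j => |(((Ψ i).coeff j : ℤ) : ℝ)|) (fun _ _ => abs_nonneg _)
        (Finset.mem_univ 0)
    have h4 : ∑ j, |(((Ψ i).coeff j : ℤ) : ℝ)| ≤ ∑ i, ∑ j, |(((Ψ i).coeff j : ℤ) : ℝ)| :=
      Finset.single_le_sum (f := fun i => ∑ j, |(((Ψ i).coeff j : ℤ) : ℝ)|)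
        (fun _ _ => Finset.sum_nonneg fun _ _ => abs_nonneg _) (Finset.mem_univ i)
    linarith
  have hconst : |(((Ψ i).const : ℤ) : ℝ)| ≤ L * N := by
    have h3 : |(((Ψ i).const : ℤ) : ℝ) / N| ≤ ∑ i, |(((Ψ i).const : ℤ) : ℝ) / N| :=
      Finset.single_le_sum (f := fun i => |(((Ψ i).const : ℤ) : ℝ) / N|) (fun _ _ => abs_nonneg _)
        (Finset.mem_univ i)
    have hN' : (0 : ℝ) < N := by exact_mod_cast hN
    have h4 : |(((Ψ i).const : ℤ) : ℝ) / N| ≤ L := by linarith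
    rw [abs_div, abs_of_pos hN', div_le_iff₀ hN'] at h4
    exact h4
  constructor
  · have e : (((Ψ i).coeff 0).natAbs : ℝ) = |(((Ψ i).coeff 0 : ℤ) : ℝ)| := by
      rw [← Int.cast_abs, ← Int.natCast_natAbs]; rfl
    exact_mod_cast e ▸ hcoeff
  · have e : (((Ψ i).const).natAbs : ℝ) = |(((Ψ i).const : ℤ) : ℝ)| := by
      rw [← Int.cast_abs, ← Int.natCast_natAbs]; rfl
    exact_mod_cast e ▸ hconst

/-- The weight of a sieve tuple: `|∏_{i} μ(t_i) log(R_i/t_i)| ≤ W^k` when `1 ≤ t_i ≤ R_i` and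
`log R_i ≤ W`. [folklore] -/
theorem abs_tupleWeight_le {k : ℕ} {R : Fin k → ℝ} {W : ℝ} (hW : ∀ i, Real.log (R i) ≤ W)
    {t : Fin k → ℕ} (ht : t ∈ Fintype.piFinset (fun i => Finset.Icc 1 ⌊R i⌋₊)) :
    |∏ i, (μ (t i) : ℝ) * Real.log (R i / t i)| ≤ W ^ k := by
  rw [Finset.abs_prod]
  have hti : ∀ i, 1 ≤ t i ∧ (t i : ℝ) ≤ R i := by
    intro i
    have h := Finset.mem_Icc.1 (Fintype.mem_piFinset.1 ht i)
    have hR : 0 ≤ R i := by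
      by_contra hneg
      push Not at hneg
      have : ⌊R i⌋₊ = 0 := Nat.floor_of_nonpos hneg.le
      omega
    exact ⟨h.1, le_trans (by exact_mod_cast h.2) (Nat.floor_le hR)⟩
  calc ∏ i, |(μ (t i) : ℝ) * Real.log (R i / t i)| ≤ ∏ _i : Fin k, W := by
        refine Finset.prod_le_prod (fun i _ => abs_nonneg _) fun i _ => ?_
        obtain ⟨h1, h2⟩ := hti i
        have h1' : (1 : ℝ) ≤ t i := by exact_mod_cast h1
        have hlog0 : 0 ≤ Real.log (R i / t i) := Real.log_nonneg ((one_le_div (by linarith)).2 h2)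
        have hRpos : 0 < R i := by linarith
        have hlogR : Real.log (R i / t i) ≤ Real.log (R i) :=
          Real.log_le_log (div_pos hRpos (by linarith)) (div_le_self hRpos.le h1')
        have hμ : |(μ (t i) : ℝ)| ≤ 1 := by exact_mod_cast ArithmeticFunction.abs_moebius_le_one
        rw [abs_mul, abs_of_nonneg hlog0]
        calc |(μ (t i) : ℝ)| * Real.log (R i / t i) ≤ 1 * W :=
              mul_le_mul hμ (hlogR.trans (hW i)) hlog0 zero_le_one
          _ = W := one_mul W
    _ = W ^ k := by rw [Finset.prod_const, Finset.card_univ, Fintype.card_fin]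

/-- **Summing the tuple bounds.** See the file header. [cite: GoldstonYildirim2001, §"mixed correlations"] -/
theorem moebiusTermSum_le_explicit : ∃ c C : ℝ, 0 < c ∧ 0 ≤ C ∧ ∀ (k : ℕ) (Ψ : Fin (k + 1) → AffLinForm 1) (K : Set (Fin 1 → ℝ)) (L N X P Qm : ℕ) (R : Fin (k + 1) → ℝ) (W Rmin S : ℝ) (G : ℕ → ℝ), IsNondegenerateSystem Ψ → affLinSize Ψ N ≤ L → Convex ℝ K → K ⊆ realBox 1 N → 1 ≤ N → X = 2 * L * N → P = ∏ i : Fin k, ⌊R i.succ⌋₊ → Qm = L * P → (∀ i, 1 ≤ R i) → 0 ≤ W → (∀ i : Fin k, Real.log (R i.succ) ≤ W) → 1 ≤ Rmin → Rmin * Qm ≤ R 0 → (Qm : ℝ) ≤ Rmin → (∀ q, 0 ≤ G q) → (∀ q ∈ Finset.Icc 1 Qm, ∀ w : ℕ, 1 ≤ w → w ≤ X → ∀ u : (ZMod q)ˣ, |chebyshevPsiMod q (u : ZMod q) w - w / Nat.totient q| ≤ G q) → (∀ q ∈ Finset.Icc 1 Qm, G q ≤ 3 * X * Real.log X * q.divisors.card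 / q) → ∑ q ∈ Finset.Icc 1 Qm, G q ≤ S → |moebiusTermSum Ψ K N R| ≤ W ^ k * (2 * (L ^ k * Real.sqrt (3 * X * Real.log X * (1 + Real.log Qm) ^ (2 ^ (2 * k + 1))) * Real.sqrt S) + P * (Qm * (Nat.log 2 X + 1) * Real.log X) + X * (C * Real.exp (-c * Real.sqrt (Real.log Rmin))) * (L ^ k * (1 + Real.log Qm) ^ (2 ^ (k + 1))) + P * (R 0 * (Real.log (R 0) + 1))) := by
  classical
  obtain ⟨c, C, hc, hC, hTB⟩ := tupleBound
  refine ⟨c, C, hc, hC, ?_⟩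
  intro k Ψ K L N X P Qm R W Rmin S G hΨ hsize hK hKN hN hX hP hQm hR1 hW0 hW hRmin hRQ hQR hG0 hGpt
    hGtriv hGsum
  -- data of the system
  have hcoeff : ∀ i, (Ψ i).coeff 0 ≠ 0 := by
    intro i h0
    apply hΨ.1 i
    funext j
    rw [Fin.fin_one_eq_zero j, h0]
    rfl
  have hsz := fun i => natAbs_le_of_affLinSize_le hN hsize i
  have haL : ((Ψ 0).coeff 0).natAbs ≤ L := (hsz 0).1
  have hbL : ((Ψ 0).const).natAbs ≤ L * N := (hsz 0).2
  have hL1 : 1 ≤ L := le_trans (Int.natAbs_pos.2 (hcoeff 0)) haL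
  have hR0' : ∀ i, 0 ≤ R i := fun i => le_trans zero_le_one (hR1 i)
  set E : ℝ := C * Real.exp (-c * Real.sqrt (Real.log Rmin)) with hE
  have hE0 : 0 ≤ E := mul_nonneg hC (Real.exp_pos _).le
  -- the expansion over tuples
  obtain ⟨m₁, m₂, hm₁, hm₂, hpos, hexp⟩ := moebiusTermSum_expand k N Ψ K R hK hKN hR0'
  rw [hexp]
  set T := Fintype.piFinset (fun i : Fin k => Finset.Icc 1 ⌊R i.succ⌋₊) with hT
  have hcardT : #T = P := by
    rw [hT, Fintype.card_piFinset, hP]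
    exact Finset.prod_congr rfl fun i _ => by rw [Nat.card_Icc]; omega
  have hPle : ∀ t ∈ T, ∏ i, t i ≤ P := by
    intro t ht
    rw [hP]
    exact Finset.prod_le_prod' fun i _ => (Finset.mem_Icc.1 (Fintype.mem_piFinset.1 ht i)).2
  have hP1 : 1 ≤ P := by
    rw [hP]
    exact Nat.one_le_iff_ne_zero.2 (Finset.prod_pos fun i _ => Nat.floor_pos.2 (hR1 i.succ)).ne'
  have hQm1 : 1 ≤ Qm := by rw [hQm]; exact Nat.mul_pos hL1 hP1
  -- one modulus per tuple
  have key : ∀ t : Fin k → ℕ, ∃ Q : ℕ, t ∈ T → (0 < Q ∧ Q ∣ ((Ψ 0).coeff 0).natAbs * ∏ i, t i ∧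
      (∀ i, ∃ g m : ℕ, g ∣ ((Ψ i.succ).coeff 0).natAbs ∧ m ∣ Q ∧ t i = g * m) ∧
      ∀ (R' Rmin' : ℝ), 1 ≤ Rmin' → Rmin' * Q ≤ R' → (Q : ℝ) ≤ Rmin' → ∀ Gq : ℝ,
        (∀ w : ℕ, 1 ≤ w → w ≤ X → ∀ u : (ZMod Q)ˣ,
          |chebyshevPsiMod Q (u : ZMod Q) w - w / Nat.totient Q| ≤ Gq) →
        |∑ m ∈ (Finset.Icc m₁ m₂).filter (fun m => ∀ i, ((t i : ℕ) : ℤ) ∣ (Ψ i.succ).eval (fun _ => m)),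
            (intVonMangoldt ((Ψ 0).eval fun _ => m) - lambdaR R' ((Ψ 0).eval fun _ => m))| ≤
          2 * Gq + Q * (Nat.log 2 X + 1) * Real.log X +
            (X : ℝ) / Q * Q.divisors.card * (C * Real.exp (-c * Real.sqrt (Real.log Rmin'))) +
            R' * (Real.log R' + 1)) := by
    intro t
    by_cases ht : t ∈ T
    · have htpos : ∀ i, 0 < t i := fun i => (Finset.mem_Icc.1 (Fintype.mem_piFinset.1 ht i)).1
      obtain ⟨Q, hQ⟩ := hTB k Ψ L N X m₁ m₂ t hcoeff haL hbL hm₁ hm₂ (fun m hm => hpos m hm 0) htpos hX hN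
      exact ⟨Q, fun _ => hQ⟩
    · exact ⟨1, fun h => absurd h ht⟩
  choose Qf hQf using key
  -- the moduli are in `[1, Qm]`
  have hQfmem : ∀ t ∈ T, Qf t ∈ Finset.Icc 1 Qm := by
    intro t ht
    obtain ⟨hQ0, hQdvd, -, -⟩ := hQf t ht
    rw [Finset.mem_Icc]
    refine ⟨hQ0, ?_⟩
    have h1 : 0 < ((Ψ 0).coeff 0).natAbs * ∏ i, t i :=
      Nat.mul_pos (Int.natAbs_pos.2 (hcoeff 0)) (Finset.prod_pos fun i _ =>
        (Finset.mem_Icc.1 (Fintype.mem_piFinset.1 ht i)).1)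
    calc Qf t ≤ ((Ψ 0).coeff 0).natAbs * ∏ i, t i := Nat.le_of_dvd h1 hQdvd
      _ ≤ L * P := Nat.mul_le_mul haL (hPle t ht)
      _ = Qm := hQm.symm
  -- the bound for each tuple
  have hX0 : 0 ≤ Real.log X := Real.log_natCast_nonneg X
  have hJ0 : 0 ≤ ((Nat.log 2 X : ℕ) : ℝ) + 1 := by positivity
  have htuple : ∀ t ∈ T,
      |(∏ i, (μ (t i) : ℝ) * Real.log (R i.succ / t i)) *
        ∑ m ∈ (Finset.Icc m₁ m₂).filter (fun m => ∀ i, ((t i : ℕ) : ℤ) ∣ (Ψ i.succ).eval (fun _ => m)),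
          (intVonMangoldt ((Ψ 0).eval fun _ => m) - lambdaR (R 0) ((Ψ 0).eval fun _ => m))| ≤
      W ^ k * (2 * G (Qf t) + Qm * (Nat.log 2 X + 1) * Real.log X +
        X * E * ((Qf t).divisors.card / (Qf t : ℝ)) + R 0 * (Real.log (R 0) + 1)) := by
    intro t ht
    obtain ⟨hQ0, -, -, hbd⟩ := hQf t ht
    have hmem := hQfmem t ht
    have hQle : Qf t ≤ Qm := (Finset.mem_Icc.1 hmem).2
    have hQle' : (Qf t : ℝ) ≤ Qm := by exact_mod_cast hQle
    have hb := hbd (R 0) Rmin hRmin (le_trans (mul_le_mul_of_nonneg_left hQle' (by linarith)) hRQ)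
      (hQle'.trans hQR) (G (Qf t)) (fun w hw1 hwX u => hGpt (Qf t) hmem w hw1 hwX u)
    rw [abs_mul]
    refine mul_le_mul (abs_tupleWeight_le (R := fun i : Fin k => R i.succ) hW ht) (hb.trans ?_)
      (abs_nonneg _) (pow_nonneg hW0 k)
    have h1 : (Qf t : ℝ) * (Nat.log 2 X + 1) * Real.log X ≤ Qm * (Nat.log 2 X + 1) * Real.log X :=
      mul_le_mul_of_nonneg_right (mul_le_mul_of_nonneg_right hQle' hJ0) hX0
    have h2 : (X : ℝ) / (Qf t) * (Qf t).divisors.card * (C * Real.exp (-c * Real.sqrt (Real.log Rmin))) =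
        X * E * ((Qf t).divisors.card / (Qf t : ℝ)) := by rw [hE]; ring
    rw [h2]
    linarith
  -- the fibre sums
  have hfiber : ∀ h : ℕ → ℝ, (∀ q ∈ Finset.Icc 1 Qm, 0 ≤ h q) →
      ∑ t ∈ T, h (Qf t) ≤ L ^ k * ∑ Q ∈ Finset.Icc 1 Qm, (Q.divisors.card : ℝ) ^ k * h Q := by
    intro h hh
    rw [Finset.sum_comp, Finset.mul_sum]
    have himg : T.image Qf ⊆ Finset.Icc 1 Qm := by
      intro Q hQ
      obtain ⟨t, ht, rfl⟩ := Finset.mem_image.1 hQ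
      exact hQfmem t ht
    refine le_trans (Finset.sum_le_sum fun Q hQ => ?_)
      (Finset.sum_le_sum_of_subset_of_nonneg himg fun Q hQ _ => ?_)
    · -- multiplicity of the modulus `Q`
      have hQmem := himg hQ
      have hQ0 : Q ≠ 0 := by have := (Finset.mem_Icc.1 hQmem).1; omega
      have hA : ∀ i : Fin k, ((Ψ i.succ).coeff 0).natAbs ≠ 0 := fun i => Int.natAbs_ne_zero.2 (hcoeff i.succ)
      have hcard := card_fiber_le T hA Qf hQ0 (fun t ht htQ i => by
        obtain ⟨-, -, hfib, -⟩ := hQf t ht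
        rw [← htQ]; exact hfib i)
      have hcard' : (#(T.filter (fun t => Qf t = Q)) : ℝ) ≤ L ^ k * (Q.divisors.card : ℝ) ^ k := by
        have h1 : ∏ i : Fin k, (#((Ψ i.succ).coeff 0).natAbs.divisors * #Q.divisors) ≤
            ∏ _i : Fin k, (L * #Q.divisors) :=
          Finset.prod_le_prod' fun i _ => Nat.mul_le_mul_right _
            ((Nat.card_divisors_le_self _).trans (hsz i.succ).1)
        rw [Finset.prod_const, Finset.card_univ, Fintype.card_fin] at h1
        have h2 : (#(T.filter (fun t => Qf t = Q)) : ℝ) ≤ ((L * #Q.divisors) ^ k : ℕ) := by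
          exact_mod_cast hcard.trans h1
        refine h2.trans (le_of_eq ?_)
        push_cast; ring
      rw [nsmul_eq_mul]
      calc (#(T.filter (fun t => Qf t = Q)) : ℝ) * h Q ≤ (L ^ k * (Q.divisors.card : ℝ) ^ k) * h Q :=
            mul_le_mul_of_nonneg_right hcard' (hh Q hQmem)
        _ = L ^ k * ((Q.divisors.card : ℝ) ^ k * h Q) := by ring
    · exact mul_nonneg (pow_nonneg (Nat.cast_nonneg _) _) (mul_nonneg (pow_nonneg (Nat.cast_nonneg _) _)
        (hh Q hQ))
  -- divisor sums over `[1, Qm]`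
  have hIcc : Finset.Icc 1 Qm = Finset.Ioc 0 Qm := by
    rw [← Finset.Icc_add_one_left_eq_Ioc, zero_add]
  have hdiv : ∀ j : ℕ, ∑ Q ∈ Finset.Icc 1 Qm, (Q.divisors.card : ℝ) ^ j / Q ≤ (1 + Real.log Qm) ^ (2 ^ j) := by
    intro j; rw [hIcc]; exact sum_pow_card_divisors_div_le j Qm
  -- (i) the Bombieri–Vinogradov sum with multiplicities, by Cauchy–Schwarz
  have hXlog0 : 0 ≤ 3 * (X : ℝ) * Real.log X := by positivity
  have hBV : ∑ t ∈ T, G (Qf t) ≤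
      L ^ k * Real.sqrt (3 * X * Real.log X * (1 + Real.log Qm) ^ (2 ^ (2 * k + 1))) * Real.sqrt S := by
    refine (hfiber G fun q _ => hG0 q).trans ?_
    rw [mul_assoc]
    refine mul_le_mul_of_nonneg_left ?_ (pow_nonneg (Nat.cast_nonneg _) _)
    have hcs := sum_mul_le_sqrt_mul_sqrt (Finset.Icc 1 Qm) (fun Q => (Q.divisors.card : ℝ) ^ k) G
      (fun q _ => hG0 q)
    refine hcs.trans (mul_le_mul ?_ (Real.sqrt_le_sqrt hGsum) (Real.sqrt_nonneg _) (Real.sqrt_nonneg _))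
    refine Real.sqrt_le_sqrt ?_
    calc ∑ Q ∈ Finset.Icc 1 Qm, ((Q.divisors.card : ℝ) ^ k) ^ 2 * G Q
        ≤ ∑ Q ∈ Finset.Icc 1 Qm, 3 * X * Real.log X * ((Q.divisors.card : ℝ) ^ (2 * k + 1) / Q) := by
          refine Finset.sum_le_sum fun Q hQ => ?_
          have hτ0 : 0 ≤ ((Q.divisors.card : ℝ) ^ k) ^ 2 := by positivity
          calc ((Q.divisors.card : ℝ) ^ k) ^ 2 * G Q
              ≤ ((Q.divisors.card : ℝ) ^ k) ^ 2 * (3 * X * Real.log X * Q.divisors.card / Q) :=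
                mul_le_mul_of_nonneg_left (hGtriv Q hQ) hτ0
            _ = 3 * X * Real.log X * ((Q.divisors.card : ℝ) ^ (2 * k + 1) / Q) := by ring
      _ = 3 * X * Real.log X * ∑ Q ∈ Finset.Icc 1 Qm, (Q.divisors.card : ℝ) ^ (2 * k + 1) / Q := by
          rw [Finset.mul_sum]
      _ ≤ 3 * X * Real.log X * (1 + Real.log Qm) ^ (2 ^ (2 * k + 1)) :=
          mul_le_mul_of_nonneg_left (hdiv _) hXlog0
  -- (ii) the Goldston–Yıldırım error with multiplicities
  have hGY : ∑ t ∈ T, ((Qf t).divisors.card / (Qf t : ℝ)) ≤ L ^ k * (1 + Real.log Qm) ^ (2 ^ (k + 1)) := by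
    refine (hfiber (fun q => (q.divisors.card : ℝ) / q) fun q _ => by positivity).trans ?_
    refine mul_le_mul_of_nonneg_left ?_ (pow_nonneg (Nat.cast_nonneg _) _)
    refine le_trans (le_of_eq (Finset.sum_congr rfl fun Q _ => ?_)) (hdiv (k + 1))
    rw [pow_succ]; ring
  -- assembling
  have hWk : 0 ≤ W ^ k := pow_nonneg hW0 k
  calc |∑ t ∈ T, (∏ i, (μ (t i) : ℝ) * Real.log (R i.succ / t i)) *
          ∑ m ∈ (Finset.Icc m₁ m₂).filter (fun m => ∀ i, ((t i : ℕ) : ℤ) ∣ (Ψ i.succ).eval (fun _ => m)),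
            (intVonMangoldt ((Ψ 0).eval fun _ => m) - lambdaR (R 0) ((Ψ 0).eval fun _ => m))|
      ≤ ∑ t ∈ T, |(∏ i, (μ (t i) : ℝ) * Real.log (R i.succ / t i)) *
          ∑ m ∈ (Finset.Icc m₁ m₂).filter (fun m => ∀ i, ((t i : ℕ) : ℤ) ∣ (Ψ i.succ).eval (fun _ => m)),
            (intVonMangoldt ((Ψ 0).eval fun _ => m) - lambdaR (R 0) ((Ψ 0).eval fun _ => m))| :=
        Finset.abs_sum_le_sum_abs _ _
    _ ≤ ∑ t ∈ T, W ^ k * (2 * G (Qf t) + Qm * (Nat.log 2 X + 1) * Real.log X +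
          X * E * ((Qf t).divisors.card / (Qf t : ℝ)) + R 0 * (Real.log (R 0) + 1)) :=
        Finset.sum_le_sum htuple
    _ = W ^ k * (2 * ∑ t ∈ T, G (Qf t) + #T * (Qm * (Nat.log 2 X + 1) * Real.log X) +
          X * E * ∑ t ∈ T, ((Qf t).divisors.card / (Qf t : ℝ)) + #T * (R 0 * (Real.log (R 0) + 1))) := by
        rw [← Finset.mul_sum, Finset.sum_add_distrib, Finset.sum_add_distrib, Finset.sum_add_distrib,
          Finset.mul_sum, Finset.mul_sum, Finset.sum_const, Finset.sum_const, nsmul_eq_mul, nsmul_eq_mul]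
    _ ≤ W ^ k * (2 * (L ^ k * Real.sqrt (3 * X * Real.log X * (1 + Real.log Qm) ^ (2 ^ (2 * k + 1))) *
          Real.sqrt S) + P * (Qm * (Nat.log 2 X + 1) * Real.log X) +
          X * E * (L ^ k * (1 + Real.log Qm) ^ (2 ^ (k + 1))) + P * (R 0 * (Real.log (R 0) + 1))) := by
        rw [hcardT]
        refine mul_le_mul_of_nonneg_left ?_ hWk
        have h1 : 2 * ∑ t ∈ T, G (Qf t) ≤ 2 * (L ^ k * Real.sqrt (3 * X * Real.log X *
            (1 + Real.log Qm) ^ (2 ^ (2 * k + 1))) * Real.sqrt S) := by linarith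
        have h2 : (X : ℝ) * E * ∑ t ∈ T, ((Qf t).divisors.card / (Qf t : ℝ)) ≤
            X * E * (L ^ k * (1 + Real.log Qm) ^ (2 ^ (k + 1))) :=
          mul_le_mul_of_nonneg_left hGY (by positivity)
        linarith

end Summit.Parity.GeneralizedHardyLittlewood.Cruxes.RelativeDimOne.SingleMoebiusSplit
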